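import Mathlib
import Summits.NavierStokesRegularity.NavierStokesRegularity.Theorems.TypeIQuarterGateScarEnvelopeTypeIBudgetCompactness

/-!
# Crux `ScarEnvelopeTypeI` (stmt-NavierStokesRegularity-23843) — Part T0: sequence compactness with the energy bound of the limit by EVERY EVENTUAL BOUND of the approximants (constant 1)

Part T0 of nsreg-p3's ROUND-39 artefact: `local_typeI_compactness_twin_inBall_evt` — the tree's sequence-compactness theorem
`…BudgetCompactness.local_typeI_compactness_twin_inBall` (Steps 0–3, 5 VERBATIM) with the energy bound of the limit SHARPENED to constant 1
and quantified over eventual bounds («eventual-bound clause», ref3 F1: `𝐈(limit) ≤ I'` for every eventual bound `I'` of the levels of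
the approximants along the extracted subsequence).

PROVENANCE: declaration texts VERBATIM from the HOME artefact of the instrument seat nsreg-p3 g27 (cell `pub/ns-regularity-ideate`):
`round-39/Rigid39.lean` (sha16 `26407934d39cc04d`, parts `partT0.lean`/`partT1.lean`; a standalone module written against the TREE;
memo `round-39/ROUND-39.md` 5db3c59e41d183b7), scored PASS ★★ by referee ref3 g27 (`SCORE-p3-ROUND-39-0828.md` 653f7ae86a8d9398); the author cannot write under `Theorems/`
(`perm.theorems-prover-only`); landed by the prover ns-es-p1 g5 as landing hand of record (director-ns DIRECTOR-NS #237 (3)), split into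
≤ 400-line modules, `E3` spelled out, the artefact's `#guard_msgs … #print axioms` certificates not landed.
`--supports stmt-NavierStokesRegularity-23843 --as helper`.

HONEST FRAMING: instrument theorems about HYPOTHETICAL Type-I zoom limits (Albritton–Barker objects of the census of crux
`TypeIQuarterGate.ScarEnvelopeTypeI`, item 23843); the analytic input is the tree's closure engine (compactness
`local_typeI_compactness_twin_inBall`, sharpened to constant 1 in Part S1; Q1 whole-space), P1 rate inheritance, L8 persistence and the
tree's PROVED small-constant Liouville theorem; Parts R/S are order theory on the re-classing and closure lemmas.  NOTHING OPEN IS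
PROVED: 23843, (L′) `TypeILiouvilleAB` / (L′₀), the GLOBAL (S∞) = `CritAttained`, (M𝐈₁), (E1⁺), (E2ᵣ), route ExtremalTypeIConstant's
cruxes, N0 and Navier–Stokes regularity are OPEN; `critRate`, `levelCrit I`, `liouvilleRate` are `sInf`s that are `0` by junk value
when the defining set is empty (every statement using them carries the nonemptiness hypothesis explicitly).
-/

-- the summit-side namespace repeats a component by design (single-conjunct summit, D-0017)
set_option linter.dupNamespace false

open MeasureTheory Set Function Filter Topology TopologicalSpace Metric
open scoped NNReal ENNReal
open Literature.Analysis Literature.Analysis.FluidPDE Literature.Analysis.FluidPDE.LocalTypeIBlowup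
open Summit.NavierStokesRegularity.NavierStokesRegularity.Cruxes.ScarEnvelopeTypeI.ScarZoom
  (isBackwardSingularPoint_of_translated_persistence)

namespace Summit.NavierStokesRegularity.NavierStokesRegularity.Cruxes.ScarEnvelopeTypeI.SliceBudget

/-- `n + 1 ≤ 2 ^ (n + 1)` in `ℝ`. -/
private theorem nat_succ_le_two_pow₃ (n : ℕ) : ((n : ℝ) + 1) ≤ (2 : ℝ) ^ (n + 1) := by
  have h : n + 1 ≤ 2 ^ (n + 1) := (Nat.lt_two_pow_self (n := n + 1)).le
  exact_mod_cast h

/-- **T0 (LIMINF FORM, constant 1): Compactness of Type-I-bounded suitable weak solutions given on growing balls, with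
persistence of singularities at every blow-up point of the closed backward slab and the
Albritton–Barker class of the limit on every ball** (Albritton–Barker 2019, §3 with Lemma 2.2 and
Prop. 2.3; Barker–Prange 2020, Lemma 3 and §4 Step 3; Rusin–Šverák 2011, Lemma 2.1).  Let
`(v_k, q_k)` be in Albritton–Barker's class Def. 2.1 on `Q(0, 2ᵐ)` for all `m ≤ k`, with weak
spatial gradients `G_k` there and `𝐈(Q(0, 2ᵐ); v_k, q_k, G_k) ≤ I < ∞`.  Then along a subsequence
`σ` the `v_{σ j}` converge in `L³(Q(0, R))` for every `R > 0` to a pair `(u, p)` which is in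
Albritton–Barker's class on EVERY `Q(0, R)` (`IsSuitableWeakSolutionInBall R 0 u p`: suitable in the
ball, `u ∈ L^∞_t L²_x`, a weak gradient in `L²`, `p ∈ L^{3/2}(Q(0, R))` — up to the final time), is
a suitable weak solution on the backward slab with a weak gradient `H` and `𝐈(u, p, H) ≤ I` (SHARP: the tree's
`local_typeI_compactness_twin_inBall` has `4 I`, bounding each of the four terms `A, C, D, E` by `I`; here the four
terms are first made convergent along a sub-subsequence and bounded by their limits, whose SUM is `≤ I`),
`u ∈ L³(Q(0, R))` for every `R > 0`; and for every point `z` with `z.1 ≤ 0`: IF the approximants blow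
up in `L^∞(Q(z, R))` along `σ` for every `0 < R < 1`, then `z` is a backward singular point of `u`.
(The landed `ScarZoom.local_typeI_compactness_twin`, p608980, is this statement without the
`IsSuitableWeakSolutionInBall` clause; the proof is the same, the clause being read off Step 2.) -/
theorem local_typeI_compactness_twin_inBall_evt (I : ℝ≥0∞)
    (v : ℕ → ℝ → (EuclideanSpace ℝ (Fin 3)) → (EuclideanSpace ℝ (Fin 3)))
    (q : ℕ → ℝ → (EuclideanSpace ℝ (Fin 3)) → ℝ)
    (G : ℕ → ℝ → (EuclideanSpace ℝ (Fin 3)) → (EuclideanSpace ℝ (Fin 3)) →L[ℝ] (EuclideanSpace ℝ (Fin 3)))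
    (hI : I < ⊤)
    (hball : ∀ m k : ℕ, m ≤ k → IsSuitableWeakSolutionInBall ((2 : ℝ) ^ m) 0 (v k) (q k))
    (hwg : ∀ m k : ℕ, m ≤ k →
      HasWeakSpatialGradientOn (parabolicCylinderOpens ((2 : ℝ) ^ m) (0 : ℝ × (EuclideanSpace ℝ (Fin 3))))
        (v k) (G k))
    (hbd : ∀ m k : ℕ, m ≤ k →
      typeIBound (parabolicCylinder ((2 : ℝ) ^ m) (0 : ℝ × (EuclideanSpace ℝ (Fin 3)))) (v k) (q k) (G k) ≤ I) :
    ∃ (u : ℝ → (EuclideanSpace ℝ (Fin 3)) → (EuclideanSpace ℝ (Fin 3)))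
      (p : ℝ → (EuclideanSpace ℝ (Fin 3)) → ℝ)
      (H : ℝ → (EuclideanSpace ℝ (Fin 3)) → (EuclideanSpace ℝ (Fin 3)) →L[ℝ] (EuclideanSpace ℝ (Fin 3)))
      (σ : ℕ → ℕ),
      StrictMono σ ∧
      (∀ R : ℝ, 0 < R → IsSuitableWeakSolutionInBall R 0 u p) ∧
      IsSuitableWeakSolutionOn (slab (EuclideanSpace ℝ (Fin 3)) (Iio 0) isOpen_Iio) 1 0 u p ∧
      HasWeakSpatialGradientOn (slab (EuclideanSpace ℝ (Fin 3)) (Iio 0) isOpen_Iio) u H ∧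
      (∀ I' : ℝ≥0∞, (∀ᶠ k in atTop, ∀ m : ℕ, m ≤ k →
        typeIBound (parabolicCylinder ((2 : ℝ) ^ m) (0 : ℝ × (EuclideanSpace ℝ (Fin 3)))) (v k) (q k) (G k) ≤ I') →
        typeIBound (Iio (0 : ℝ) ×ˢ univ) u p H ≤ I') ∧
      (∀ R : ℝ, 0 < R → MemLp (uncurry u) 3
        (volume.restrict (parabolicCylinder R (0 : ℝ × (EuclideanSpace ℝ (Fin 3)))))) ∧
      (∀ R : ℝ, 0 < R → Tendsto (fun j => eLpNorm (uncurry (v (σ j)) - uncurry u) 3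
        (volume.restrict (parabolicCylinder R (0 : ℝ × (EuclideanSpace ℝ (Fin 3)))))) atTop (𝓝 0)) ∧
      (∀ z : ℝ × (EuclideanSpace ℝ (Fin 3)), z.1 ≤ 0 →
        (∀ R ∈ Ioo (0 : ℝ) 1, limsup (fun j => eLpNorm (uncurry (v (σ j))) ⊤
          (volume.restrict (parabolicCylinder R z))) atTop = ⊤) →
        IsBackwardSingularPoint u z) := by
  have hItop : I ≠ ⊤ := hI.ne
  have hcc_pos : ∀ m : ℕ, (0 : ℝ) < (2 : ℝ) ^ m := fun m => by positivity
  have hcc_one : ∀ m : ℕ, (1 : ℝ) ≤ (2 : ℝ) ^ m := fun m => one_le_pow₀ (by norm_num)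
  -- ## Step 0: normalise the pressures to unit-ball mean zero
  set qn : ℕ → ℝ → (EuclideanSpace ℝ (Fin 3)) → ℝ :=
    fun k t x => q k t x - ⨍ y in ball (0 : (EuclideanSpace ℝ (Fin 3))) 1, q k t y with hqn
  have hballn : ∀ m k : ℕ, m ≤ k → IsSuitableWeakSolutionInBall ((2 : ℝ) ^ m) 0 (v k) (qn k) :=
    fun m k hmk => isSuitableWeakSolutionInBall_sub_unitBallMean (hcc_one m) (hball m k hmk)
  have hbdn : ∀ m k : ℕ, m ≤ k →
      typeIBound (parabolicCylinder ((2 : ℝ) ^ m) (0 : ℝ × (EuclideanSpace ℝ (Fin 3)))) (v k) (qn k) (G k) ≤ I := by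
    intro m k hmk
    show typeIBound _ (v k) (fun t x => q k t x - ⨍ y in ball (0 : (EuclideanSpace ℝ (Fin 3))) 1, q k t y)
      (G k) ≤ I
    rw [typeIBound_sub_unitBallMean_ball (hball m k hmk).2.2.2]
    exact hbd m k hmk
  have h0 : ∀ k t, ⨍ y in ball (0 : (EuclideanSpace ℝ (Fin 3))) 1, qn k t y = 0 := fun k t =>
    unitBallMean_normalised (q k) t
  -- ## Step 1: the uniform `L³ × L^{3/2}` bounds at every level
  have hbd2 : ∀ m : ℕ, (⨆ k, ⨆ (_ : m ≤ k), (eLpNorm (uncurry (v k)) 3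
        (volume.restrict (parabolicCylinder ((2 : ℝ) ^ m) (0 : ℝ × (EuclideanSpace ℝ (Fin 3))))) +
      eLpNorm (uncurry (qn k)) (3 / 2)
        (volume.restrict (parabolicCylinder ((2 : ℝ) ^ m) (0 : ℝ × (EuclideanSpace ℝ (Fin 3))))))) < ∞ := by
    intro m
    set Cv : ℝ≥0∞ := (ENNReal.ofReal ((2 : ℝ) ^ m) ^ 2 * I) ^ (1 / 3 : ℝ) with hCv
    set Cq : ℝ≥0∞ := (2 * (1 + volume (ball (0 : (EuclideanSpace ℝ (Fin 3))) ((2 : ℝ) ^ m)) *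
        (volume (ball (0 : (EuclideanSpace ℝ (Fin 3))) 1))⁻¹) * (ENNReal.ofReal ((2 : ℝ) ^ m) ^ 2 * I)) ^
          (2 / 3 : ℝ) with hCq
    refine lt_of_le_of_lt (iSup₂_le fun k hmk => add_le_add ?_ ?_) (b := Cv + Cq) ?_
    · refine (eLpNorm_velocity_ball_le (hcc_pos m) Subset.rfl (qn k) (G k)).trans ?_
      exact ENNReal.rpow_le_rpow (mul_le_mul' le_rfl (hbdn m k hmk)) (by norm_num)
    · refine (eLpNorm_pressure_ball_le (hcc_one m) (hballn m k hmk).2.2.2.1 (h0 k) Subset.rfl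
        (v k) (G k)).trans ?_
      exact ENNReal.rpow_le_rpow (mul_le_mul' le_rfl (mul_le_mul' le_rfl (hbdn m k hmk))) (by norm_num)
    · refine ENNReal.add_lt_top.2 ⟨?_, ?_⟩
      · exact ENNReal.rpow_lt_top_of_nonneg (by norm_num)
          (ENNReal.mul_ne_top (ENNReal.pow_ne_top ENNReal.ofReal_ne_top) hItop)
      · refine ENNReal.rpow_lt_top_of_nonneg (by norm_num) ?_
        rw [← mul_assoc]
        exact ENNReal.mul_ne_top (pressureConst_lt_top ((2 : ℝ) ^ m)).ne hItop
  -- ## Step 2: the limit along one subsequence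
  obtain ⟨u, p, σ, hσ, hlim⟩ := local_suitableCompactness hballn hbd2
  -- ## Step 3: suitability on the slab and the weak gradient, by exhaustion
  have hswu : IsSuitableWeakSolutionOn (slab (EuclideanSpace ℝ (Fin 3)) (Iio 0) isOpen_Iio) 1 0 u p :=
    ESSBlowup.isSuitableWeakSolutionOn_halfspace fun a ha => (hlim a ha).1
  set Qn : ℕ → Opens (ℝ × (EuclideanSpace ℝ (Fin 3))) :=
    fun n => parabolicCylinderOpens ((n : ℝ) + 1) (0 : ℝ × (EuclideanSpace ℝ (Fin 3))) with hQn
  have hmono : Monotone Qn := fun m n hmn z hz =>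
    SuitableCompactness.parabolicCylinder_zero_mono (by positivity) (by simpa using hmn) hz
  have hcov : ∀ K ⊆ ((slab (EuclideanSpace ℝ (Fin 3)) (Iio 0) isOpen_Iio :
      Opens (ℝ × (EuclideanSpace ℝ (Fin 3)))) : Set (ℝ × (EuclideanSpace ℝ (Fin 3)))),
      IsCompact K → ∃ n, K ⊆ (Qn n : Set (ℝ × (EuclideanSpace ℝ (Fin 3)))) := fun K hK hKc =>
    ESSBlowup.exists_subset_parabolicCylinder_of_isCompact hK hKc
  choose Gn hGn hGn2 using fun n : ℕ => (hlim ((n : ℝ) + 1) (by positivity)).1.2.2.1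
  obtain ⟨H, hH, hHae⟩ := exists_hasWeakSpatialGradientOn_of_exhaustion
    (Q := slab (EuclideanSpace ℝ (Fin 3)) (Iio 0) isOpen_Iio) (Qn := Qn) hmono hcov hGn
  -- ## Step 4 (LIMINF FORM): `𝐈(u, p, H) ≤ I'` for every eventual bound `I'` of the approximants
  have h4 : ∀ I' : ℝ≥0∞, (∀ᶠ k in atTop, ∀ m : ℕ, m ≤ k →
      typeIBound (parabolicCylinder ((2 : ℝ) ^ m) (0 : ℝ × (EuclideanSpace ℝ (Fin 3)))) (v k) (q k) (G k) ≤ I') →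
      typeIBound (Iio (0 : ℝ) ×ˢ univ) u p H ≤ I' := by
    intro I' hI'ev
    rcases eq_or_ne I' ⊤ with hI'top | hI'top
    · rw [hI'top]; exact le_top
    obtain ⟨K, hK⟩ := eventually_atTop.1 hI'ev
    have hKn : ∀ k, K ≤ k → ∀ m : ℕ, m ≤ k →
        typeIBound (parabolicCylinder ((2 : ℝ) ^ m) (0 : ℝ × (EuclideanSpace ℝ (Fin 3)))) (v k) (qn k) (G k) ≤ I' := by
      intro k hk m hmk
      show typeIBound _ (v k) (fun t x => q k t x - ⨍ y in ball (0 : (EuclideanSpace ℝ (Fin 3))) 1, q k t y)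
        (G k) ≤ I'
      rw [typeIBound_sub_unitBallMean_ball (hball m k hmk).2.2.2]
      exact hK k hk m hmk
    refine typeIBound_le_iff.2 fun r hr z hz => ?_
    obtain ⟨n, hn⟩ : ∃ n : ℕ, parabolicCylinder r z ⊆
        parabolicCylinder ((n : ℝ) + 1) (0 : ℝ × (EuclideanSpace ℝ (Fin 3))) := by
      obtain ⟨n, hn⟩ := exists_nat_ge (max (r ^ 2 - z.1) (‖z.2‖ + r))
      refine ⟨n, fun w hw => ?_⟩
      have hw0 : w.1 < 0 := (hz hw).1
      rw [mem_parabolicCylinder] at hw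
      rw [SuitableCompactness.mem_parabolicCylinder_zero]
      have h1 : r ^ 2 - z.1 ≤ n := (le_max_left _ _).trans hn
      have h2 : ‖z.2‖ + r ≤ n := (le_max_right _ _).trans hn
      have h3 : (n : ℝ) ≤ ((n : ℝ) + 1) ^ 2 := by nlinarith [n.cast_nonneg (α := ℝ)]
      refine ⟨⟨by linarith [hw.1.1], hw0⟩, ?_⟩
      calc ‖w.2‖ = ‖(w.2 - z.2) + z.2‖ := by rw [sub_add_cancel]
        _ ≤ ‖w.2 - z.2‖ + ‖z.2‖ := norm_add_le _ _
        _ < r + ‖z.2‖ := by rw [← dist_eq_norm]; linarith [hw.2]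
        _ ≤ (n : ℝ) + 1 := by linarith
    set a : ℝ := (n : ℝ) + 1 with ha
    have ha0 : 0 < a := by positivity
    have ha1 : 1 ≤ a := by rw [ha]; linarith [n.cast_nonneg (α := ℝ)]
    set Q₀ : Set (ℝ × (EuclideanSpace ℝ (Fin 3))) :=
      parabolicCylinder a (0 : ℝ × (EuclideanSpace ℝ (Fin 3))) with hQ₀
    have hzQ : parabolicCylinder r z ⊆ Q₀ := hn
    obtain ⟨hballu, hum3, hconv, hweak⟩ := hlim a ha0
    have hleΩ : parabolicCylinderOpens r z ≤
        (slab (EuclideanSpace ℝ (Fin 3)) (Iio 0) isOpen_Iio : Opens (ℝ × (EuclideanSpace ℝ (Fin 3)))) :=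
      fun w hw => hz hw
    set m₀ : ℕ := n + 1 with hm₀
    have ham₀ : a ≤ (2 : ℝ) ^ m₀ := nat_succ_le_two_pow₃ n
    have hQ₀m : Q₀ ⊆ parabolicCylinder ((2 : ℝ) ^ m₀) (0 : ℝ × (EuclideanSpace ℝ (Fin 3))) :=
      parabolicCylinder_mono ha0.le ham₀ _
    have hzm : parabolicCylinder r z ⊆
        parabolicCylinder ((2 : ℝ) ^ m₀) (0 : ℝ × (EuclideanSpace ℝ (Fin 3))) := hzQ.trans hQ₀m
    have hleΩm : parabolicCylinderOpens r z ≤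
        parabolicCylinderOpens ((2 : ℝ) ^ m₀) (0 : ℝ × (EuclideanSpace ℝ (Fin 3))) :=
      fun w hw => hzm hw
    set σ' : ℕ → ℕ := fun j => σ (j + (m₀ + K)) with hσ'
    have hσ'm : ∀ j, m₀ ≤ σ' j := fun j =>
      ((Nat.le_add_right m₀ K).trans (Nat.le_add_left _ j)).trans (hσ.id_le (j + (m₀ + K)))
    have hσ'K : ∀ j, K ≤ σ' j := fun j =>
      ((Nat.le_add_left K m₀).trans (Nat.le_add_left _ j)).trans (hσ.id_le (j + (m₀ + K)))
    have hconv' : Tendsto (fun j => eLpNorm (uncurry (v (σ' j)) - uncurry u) 3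
        (volume.restrict Q₀)) atTop (𝓝 0) := hconv.comp (tendsto_add_atTop_nat (m₀ + K))
    have hweak' : ∀ g : ℝ × (EuclideanSpace ℝ (Fin 3)) → ℝ, MemLp g 3 (volume.restrict Q₀) →
        Tendsto (fun j => ∫ w in Q₀, qn (σ' j) w.1 w.2 * g w) atTop
          (𝓝 (∫ w in Q₀, p w.1 w.2 * g w)) := fun g hg =>
      (hweak g hg).comp (tendsto_add_atTop_nat (m₀ + K))
    have hbdσ : ∀ j, abScaledSum r z (v (σ' j)) (qn (σ' j)) (G (σ' j)) ≤ I' := fun j =>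
      (abScaledSum_le_typeIBound hr hzm).trans (hKn (σ' j) (hσ'K j) m₀ (hσ'm j))
    have hvm : ∀ j, AEStronglyMeasurable (uncurry (v (σ' j))) (volume.restrict Q₀) := fun j =>
      (hballn m₀ (σ' j) (hσ'm j)).1.distributional.1.aestronglyMeasurable.mono_measure
        (Measure.restrict_mono hQ₀m le_rfl)
    have hum : AEStronglyMeasurable (uncurry u) (volume.restrict Q₀) := hum3.1
    have hqmem : ∀ j, MemLp (uncurry (qn (σ' j))) (3 / 2) (volume.restrict Q₀) := fun j =>
      (hballn m₀ (σ' j) (hσ'm j)).2.2.2.mono_measure (Measure.restrict_mono hQ₀m le_rfl)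
    have hHfin : ∫⁻ w in parabolicCylinder r z, ENNReal.ofReal (frobeniusNormSq (H w.1 w.2)) < ∞ := by
      have e : ∫⁻ w in parabolicCylinder r z, ENNReal.ofReal (frobeniusNormSq (H w.1 w.2)) =
          ∫⁻ w in parabolicCylinder r z, ENNReal.ofReal (frobeniusNormSq (Gn n w.1 w.2)) := by
        refine setLIntegral_congr_of_ae_imp (isOpen_parabolicCylinder r z).measurableSet hzQ ?_
        filter_upwards [hHae n] with w hw hwS
        have e : H w.1 w.2 = Gn n w.1 w.2 := hw hwS
        rw [e]
      rw [e]
      exact lt_of_le_of_lt (lintegral_mono_set hzQ) (hGn2 n)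
    -- ### per-term limits along a sub-subsequence (compactness of `(ℝ≥0∞)⁴`)
    obtain ⟨w, -, φ, hφ, hw⟩ := (isCompact_univ (X := (ℝ≥0∞ × ℝ≥0∞) × (ℝ≥0∞ × ℝ≥0∞))).tendsto_subseq
      (x := fun j => ((cknAEss r z (v (σ' j)), cknC r z (v (σ' j))),
        (cknDOsc r z (qn (σ' j)), cknE r z (G (σ' j))))) fun j => mem_univ _
    have hwA : Tendsto (fun j => cknAEss r z (v (σ' (φ j)))) atTop (𝓝 w.1.1) :=
      ((continuous_fst.comp continuous_fst).tendsto w).comp hw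
    have hwC : Tendsto (fun j => cknC r z (v (σ' (φ j)))) atTop (𝓝 w.1.2) :=
      ((continuous_snd.comp continuous_fst).tendsto w).comp hw
    have hwD : Tendsto (fun j => cknDOsc r z (qn (σ' (φ j)))) atTop (𝓝 w.2.1) :=
      ((continuous_fst.comp continuous_snd).tendsto w).comp hw
    have hwE : Tendsto (fun j => cknE r z (G (σ' (φ j)))) atTop (𝓝 w.2.2) :=
      ((continuous_snd.comp continuous_snd).tendsto w).comp hw
    have hbdφ : ∀ j, cknAEss r z (v (σ' (φ j))) + cknC r z (v (σ' (φ j))) +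
        cknDOsc r z (qn (σ' (φ j))) + cknE r z (G (σ' (φ j))) ≤ I' := fun j => hbdσ (φ j)
    have hsum : w.1.1 + w.1.2 + w.2.1 + w.2.2 ≤ I' :=
      le_of_tendsto' (((hwA.add hwC).add hwD).add hwE) hbdφ
    have hwT : w.1.1 ≠ ⊤ ∧ w.1.2 ≠ ⊤ ∧ w.2.1 ≠ ⊤ ∧ w.2.2 ≠ ⊤ := by
      have hw' : w.1.1 + w.1.2 + w.2.1 + w.2.2 ≠ ⊤ := ne_top_of_le_ne_top hI'top hsum
      simp only [ne_eq, ENNReal.add_eq_top, not_or] at hw'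
      exact ⟨hw'.1.1.1, hw'.1.1.2, hw'.1.2, hw'.2⟩
    refine ENNReal.le_of_forall_pos_le_add fun ε hε _ => ?_
    have hδ0 : ((ε : ℝ≥0∞) / 4) ≠ 0 :=
      (ENNReal.div_pos (ENNReal.coe_ne_zero.2 hε.ne') (by norm_num)).ne'
    have h4δ : 4 * ((ε : ℝ≥0∞) / 4) = (ε : ℝ≥0∞) :=
      ENNReal.mul_div_cancel (by norm_num) (by norm_num)
    have hev : ∀ᶠ j in atTop, cknAEss r z (v (σ' (φ j))) < w.1.1 + (ε : ℝ≥0∞) / 4 ∧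
        (cknC r z (v (σ' (φ j))) < w.1.2 + (ε : ℝ≥0∞) / 4 ∧
          (cknDOsc r z (qn (σ' (φ j))) < w.2.1 + (ε : ℝ≥0∞) / 4 ∧
            cknE r z (G (σ' (φ j))) < w.2.2 + (ε : ℝ≥0∞) / 4)) :=
      (hwA.eventually_lt_const (ENNReal.lt_add_right hwT.1 hδ0)).and
        ((hwC.eventually_lt_const (ENNReal.lt_add_right hwT.2.1 hδ0)).and
          ((hwD.eventually_lt_const (ENNReal.lt_add_right hwT.2.2.1 hδ0)).and
            (hwE.eventually_lt_const (ENNReal.lt_add_right hwT.2.2.2 hδ0))))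
    obtain ⟨j₀, hj₀⟩ := eventually_atTop.1 hev
    -- ### the shifted sub-subsequence `j ↦ σ' (φ (j + j₀))`
    have hθm : ∀ j, m₀ ≤ σ' (φ (j + j₀)) := fun j => hσ'm _
    have hθt : Tendsto (fun j => φ (j + j₀)) atTop atTop :=
      hφ.tendsto_atTop.comp (tendsto_add_atTop_nat j₀)
    have hconvθ : Tendsto (fun j => eLpNorm (uncurry (v (σ' (φ (j + j₀)))) - uncurry u) 3
        (volume.restrict Q₀)) atTop (𝓝 0) := hconv'.comp hθt
    have hweakθ : ∀ g : ℝ × (EuclideanSpace ℝ (Fin 3)) → ℝ, MemLp g 3 (volume.restrict Q₀) →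
        Tendsto (fun j => ∫ w in Q₀, qn (σ' (φ (j + j₀))) w.1 w.2 * g w) atTop
          (𝓝 (∫ w in Q₀, p w.1 w.2 * g w)) := fun g hg => (hweak' g hg).comp hθt
    have hvmθ : ∀ j, AEStronglyMeasurable (uncurry (v (σ' (φ (j + j₀))))) (volume.restrict Q₀) :=
      fun j => hvm _
    have hqmemθ : ∀ j, MemLp (uncurry (qn (σ' (φ (j + j₀))))) (3 / 2) (volume.restrict Q₀) :=
      fun j => hqmem _
    have hbA : ∀ j, cknAEss r z (v (σ' (φ (j + j₀)))) ≤ w.1.1 + (ε : ℝ≥0∞) / 4 := fun j =>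
      (hj₀ (j + j₀) (Nat.le_add_left _ _)).1.le
    have hbC : ∀ j, cknC r z (v (σ' (φ (j + j₀)))) ≤ w.1.2 + (ε : ℝ≥0∞) / 4 := fun j =>
      (hj₀ (j + j₀) (Nat.le_add_left _ _)).2.1.le
    have hbD : ∀ j, cknDOsc r z (qn (σ' (φ (j + j₀)))) ≤ w.2.1 + (ε : ℝ≥0∞) / 4 := fun j =>
      (hj₀ (j + j₀) (Nat.le_add_left _ _)).2.2.1.le
    have hbE : ∀ j, cknE r z (G (σ' (φ (j + j₀)))) ≤ w.2.2 + (ε : ℝ≥0∞) / 4 := fun j =>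
      (hj₀ (j + j₀) (Nat.le_add_left _ _)).2.2.2.le
    have hA : cknAEss r z u ≤ w.1.1 + (ε : ℝ≥0∞) / 4 :=
      cknAEss_le_of_tendsto_eLpNorm hr hzQ hvmθ hum hconvθ hbA
    have hC : cknC r z u ≤ w.1.2 + (ε : ℝ≥0∞) / 4 :=
      cknC_le_of_tendsto_eLpNorm hr hzQ hvmθ hum hconvθ hbC
    have hD : cknDOsc r z p ≤ w.2.1 + (ε : ℝ≥0∞) / 4 :=
      cknDOsc_le_of_tendsto_weakly hr hzQ hqmemθ hballu.2.2.2 hweakθ hbD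
    have hE : cknE r z H ≤ w.2.2 + (ε : ℝ≥0∞) / 4 :=
      cknE_le_of_tendsto_eLpNorm hr hzQ (fun j => (hwg m₀ (σ' (φ (j + j₀))) (hθm j)).mono hleΩm)
        (hH.mono hleΩ) hHfin hconvθ hbE
    calc abScaledSum r z u p H = cknAEss r z u + cknC r z u + cknDOsc r z p + cknE r z H := rfl
      _ ≤ (w.1.1 + (ε : ℝ≥0∞) / 4) + (w.1.2 + (ε : ℝ≥0∞) / 4) + (w.2.1 + (ε : ℝ≥0∞) / 4) +
            (w.2.2 + (ε : ℝ≥0∞) / 4) := add_le_add (add_le_add (add_le_add hA hC) hD) hE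
      _ = (w.1.1 + w.1.2 + w.2.1 + w.2.2) + 4 * ((ε : ℝ≥0∞) / 4) := by ring
      _ ≤ I' + (ε : ℝ≥0∞) := by rw [h4δ]; exact add_le_add hsum le_rfl
  -- ## Step 5: persistence of singularities at every blow-up point of the closed slab
  -- (A–B Prop. 2.3 = B–P Lemma 3, transported by translation: file `…TranslatedPersistence`)
  have hpers : ∀ z : ℝ × (EuclideanSpace ℝ (Fin 3)), z.1 ≤ 0 →
      (∀ R ∈ Ioo (0 : ℝ) 1, limsup (fun j => eLpNorm (uncurry (v (σ j))) ⊤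
        (volume.restrict (parabolicCylinder R z))) atTop = ⊤) →
      IsBackwardSingularPoint u z := fun z hz hsup =>
    isBackwardSingularPoint_of_translated_persistence hballn hbd2 hσ hlim hz hsup
  exact ⟨u, p, H, σ, hσ, fun R hR => (hlim R hR).1, hswu, hH, h4, fun R hR => (hlim R hR).2.1,
    fun R hR => (hlim R hR).2.2.1, hpers⟩

end Summit.NavierStokesRegularity.NavierStokesRegularity.Cruxes.ScarEnvelopeTypeI.SliceBudget
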